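import Literature.AlgebraicGeometry.Hu2025.Statements.S07GammaSchemes.R109bFTransforms
import HarnessLib

/-!
# Hu 2025 (arXiv:2507.21400v1), §7.3–§7.4 — Lem. 7.4 (ϑ-transforms; JOINT-J3 sentence C60L75; the (⋆a)/(⋆b)
# construction clauses), Lem. 7.5 (℘/ℓ-transforms), Cor. 7.6: statements-first typing, file c =
# `S07GammaSchemes/R109cThetaWpEllTransforms.lean` of lit/PARTITION-HU.md row 109 (imports file b `R109bFTransforms` for
# `GammaTransformChart` and its predicates; rung M-Hu-min of the campaign `res-hironaka`, D-0089). See file b's header for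
# the carrier level and conventions. Provenance: typed for row 109 by res-type-016 (typer of record, M-Hu-min re-point)
# from res-type-029's FILING-READY pre-draft (gen 5/6, split-v2 file (6), sha16 2d07a15611b1dac7; its 24 statements
# byte-identical, plus ONE in-proof inference decl `C61L12` («ϑ'_{[k]} ⊂ Γ̃⁰_{𝔙'} because …», p.136) added by the typer of
# record); every locator re-read on chunks `p0059`–`p0063`, `p0066` before filing (T9, Δ = 0).

**STATUS OF THE SOURCE (D-0012 / D-0089): UNREFEREED PREPRINT UNDER ADJUDICATION** — [Hu2025] arXiv:2507.21400v1,
`paper:arxiv-2507.21400`, locators `C<cc>L<l>` + PDF page. Statements below are `def … : Prop` CANDIDATES tagged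
`[claim: Hu2025, status: under-review]` — «STATUS: candidate statement under adjudication (D-0012/D-0089); not asserted»;
nothing is proved, nothing is asserted, no declaration takes a side. AI typing, weaker than expert review.
-/

noncomputable section

open scoped nonZeroDivisors

namespace Literature.AlgebraicGeometry.Hu2025.Statements.S07GammaSchemes

/-! ## Lem. 7.4 — ϑ-transforms in `𝒱̃_{ϑ[k]}` (standard charts of row 106) and the JOINT-J3 sentence C60L75 -/

section Lem74

variable {V V' : Type*} {A A' : Type*} [CommRing A] [CommRing A']

/-- **Lemma 7.4, the three bullets (C59L145–L167; p.134).** «Fix any subset Γ of 𝐔 [sic: of Var_𝐔, cf. Def. 7.1 C57L10]. Assume that Z_Γ is integral. Fix any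
k ∈ [Υ]. Then, we have the following: • there exists a closed subscheme Z̃_{ϑ[k],Γ} of 𝒱̃_{ϑ[k]} with an induced morphism
Z̃_{ϑ[k],Γ} → Z_Γ; • Z̃_{ϑ[k],Γ} comes equipped with an irreducible component Z̃†_{ϑ[k],Γ} with the induced morphism
Z̃†_{ϑ[k],Γ} → Z_Γ; • for any preferred admissible chart [sic: for ℛ̃_{ϑ[k]} the charts are the standard charts of row
106; PDF p.134 prints «preferred admissible chart»] 𝔙 of ℛ̃_{ϑ[k]} such that Z̃_{ϑ[k],Γ} ∩ 𝔙 ≠ ∅, there are two subsets,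
possibly empty, Γ̃⁰_𝔙 ⊂ Var_𝔙, Γ̃¹_𝔙 ⊂ Var_𝔙.»
[claim: Hu2025, status: under-review]
STATUS: candidate statement under adjudication (D-0012/D-0089); not asserted. -/
def Lem7_4_bullets {R₀ : Type*} [CommRing R₀] (hInt : Prop) (base : R₀ →+* A) (gammaWp : Ideal R₀)
    (vIdeal : Ideal A) (D : GammaTransformChart V A) : Prop :=
  hInt → D.zIdeal ≠ ⊤ → D.LiesOverGamma base gammaWp vIdeal ∧ D.IsComponent

/-- **Lemma 7.4 (1) = eq. (7.12) (C60L4–L13; PDF p.134 item (1)).** «the scheme Z̃_{ϑ[k],Γ} ∩ 𝔙, as a closed subscheme of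
the chart 𝔙, is defined by the following relations y, y ∈ Γ̃⁰_𝔙, y − 1, y ∈ Γ̃¹_𝔙, ℬ^gov_𝔙, ℬ^ngv_{𝔙,>k}, ℬ^frb_𝔙,
L_{𝔙,𝔉}» («The meaning of the notation ℬ^ngv_{𝔙,>k} below can be found in Definition 5.14», C59L142–L143). The four
families are DATA `rels` on the chart (AS PRINTED: the term-wise proper transforms, row 106 `Def5_4` — see `C60L75`;
the strict-transform reading of `Z̃ ∩ 𝔙` is the construction clause `C60L53`). JOINT J3 (G-H2) of lit/PARTITION-HU.md §4.
[claim: Hu2025, status: under-review]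
STATUS: candidate statement under adjudication (D-0012/D-0089); not asserted. -/
def Lem7_4_1 {ι : Type*} (hInt : Prop) (var : V → A) (rels : ι → A) (D : GammaTransformChart V A) : Prop :=
  hInt → D.zIdeal ≠ ⊤ → D.DefinedBy var var rels

/-- **Lemma 7.4 (1), maximality clause (C60L15–L17; p.134).** «further, we take Γ̃⁰_𝔙 ⊂ Var_𝔙 to be the maximal subset
(under inclusion) among all those subsets that satisfy the above» (PARTITION name `Lem7_4_1max`).
[claim: Hu2025, status: under-review]
STATUS: candidate statement under adjudication (D-0012/D-0089); not asserted. -/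
def Lem7_4_1max {ι : Type*} (hInt : Prop) (var : V → A) (rels : ι → A) (D : GammaTransformChart V A) : Prop :=
  hInt → D.zIdeal ≠ ⊤ → D.Gamma0Maximal var var rels

/-- **Lemma 7.4 (2) (C60L19; PDF p.134 item (2)).** «the induced morphism Z̃†_{ϑ[k],Γ} → Z_Γ is birational».
[claim: Hu2025, status: under-review]
STATUS: candidate statement under adjudication (D-0012/D-0089); not asserted. -/
def Lem7_4_2 {RΓ : Type*} [CommRing RΓ] (hInt : Prop) (D : GammaTransformChart V A)
    (φ : RΓ →+* A ⧸ D.zDagger) : Prop :=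
  hInt → D.Birational φ

/-- **Lemma 7.4 (3), first sentence (C60L21–L22; PDF p.135 item (3)).** «for any variable y ∈ Var_𝔙,
Z̃†_{ϑ[k],Γ} ∩ 𝔙 ⊂ (y = 0) if and only if Z̃_{ϑ[k],Γ} ∩ 𝔙 ⊂ (y = 0).» SET-theoretic reading; sibling `_sch` in the
record namespace.
[claim: Hu2025, status: under-review]
STATUS: candidate statement under adjudication (D-0012/D-0089); not asserted. -/
def Lem7_4_3 (hInt : Prop) (var : V → A) (D : GammaTransformChart V A) : Prop := hInt → D.ContainedInIff var

/-- **Lemma 7.4 (3), «Consequently» (C60L22–L26; p.135).** «Consequently, Z̃†_{ϑ[k],Γ} ∩ 𝔙 ⊂ Z̃_{ϑ[k+1]} ∩ 𝔙 if and only if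
Z̃_{ϑ[k],Γ} ∩ 𝔙 ⊂ Z̃_{ϑ[k+1]} ∩ 𝔙 where Z̃_{ϑ[k+1]} is the proper transform of the ϑ-center Z_{ϑ[k+1]} in ℛ̃_{ϑ[k]}.»
Typed with the chart ideal `nextCentre` of that proper transform (proof C60L104–L105: «Z̃_{ϑ[k+1]} ∩ 𝔙 = (y_0 = y_1 = 0)
for some y_0, y_1 ∈ Var_𝔙») — SET-theoretic: `nextCentre ≤ √zDagger ↔ nextCentre ≤ √zIdeal`.
[claim: Hu2025, status: under-review]
STATUS: candidate statement under adjudication (D-0012/D-0089); not asserted. -/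
def Lem7_4_3_conseq (hInt : Prop) (nextCentre : Ideal A) (D : GammaTransformChart V A) : Prop :=
  hInt → D.zDagger ≠ ⊤ → (nextCentre ≤ D.zDagger.radical ↔ nextCentre ≤ D.zIdeal.radical)

/-- **Lemma 7.4 (C59L145–C60L26; p.134–135)** = bullets ∧ (1) with maximality ∧ (2) ∧ (3) with its consequence.
[claim: Hu2025, status: under-review]
STATUS: candidate statement under adjudication (D-0012/D-0089); not asserted. -/
def Lem7_4 {ι : Type*} {R₀ RΓ : Type*} [CommRing R₀] [CommRing RΓ] (hInt : Prop) (base : R₀ →+* A)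
    (gammaWp : Ideal R₀) (vIdeal : Ideal A) (var : V → A) (rels : ι → A) (nextCentre : Ideal A)
    (D : GammaTransformChart V A) (φ : RΓ →+* A ⧸ D.zDagger) : Prop :=
  Lem7_4_bullets hInt base gammaWp vIdeal D ∧ Lem7_4_1 hInt var rels D ∧ Lem7_4_1max hInt var rels D ∧
    Lem7_4_2 hInt D φ ∧ Lem7_4_3 hInt var D ∧ Lem7_4_3_conseq hInt nextCentre D

/-- **Construction, PROPER-TRANSFORM case (C60L47–L55; p.135).** «Suppose that Z̃_{ϑ[k−1],Γ} … is not contained in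
Z'_{ϑ[k]} … We then let Z̃_{ϑ[k],Γ} (respectively, Z̃†_{ϑ[k],Γ}) be the proper transform of Z̃_{ϑ[k−1],Γ} (respectively,
Z̃†_{ϑ[k−1],Γ}) in 𝒱̃_{ϑ[k]}.» On charts `𝔙 → 𝔙'` (ring map `π`, exceptional variable `ζ` of the step, row 106
`ChartStep.pullback` / `excVar`): «proper transform» read as the STRICT transform (ζ-saturation of the total transform;
row 106 `ChartStep.strictTransform`, OURS vocabulary — the only transform of a subscheme the text could mean here),
under the hypothesis `notInCentre` (SET-theoretic: the centre ideal is not below `√zIdeal'`).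
[claim: Hu2025, status: under-review]
STATUS: candidate statement under adjudication (D-0012/D-0089); not asserted. -/
def C60L53 (π : A' →+* A) (ζ : A) (centre' : Ideal A') (D' : GammaTransformChart V' A')
    (D : GammaTransformChart V A) : Prop :=
  ¬ centre' ≤ D'.zIdeal.radical →
    D.zIdeal = ⨆ n : ℕ, (D'.zIdeal.map π).colon ({ζ ^ n} : Set A) ∧
      D.zDagger = ⨆ n : ℕ, (D'.zDagger.map π).colon ({ζ ^ n} : Set A)

/-- **Γ̃ update in the proper-transform case (C60L63–L67; p.135).** «Γ̃⁰_𝔙 = {y_𝔙 ∣ y_𝔙 is the proper transform of some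
y_{𝔙'} ∈ Γ̃⁰_{𝔙'}}; Γ̃¹_𝔙 = {y_𝔙 ∣ y_𝔙 is the proper transform of some y_{𝔙'} ∈ Γ̃¹_{𝔙'}}.» On the fixed index type of row
106 (`V' = V`, `y'_i ↦ y_i`, `y'_{i₀} ↦ ζ`; «proper transform of a variable» = row 106 `Def5_2`), with the predicate
`IsPT y y'` as a parameter: the new sets are the images.
[claim: Hu2025, status: under-review]
STATUS: candidate statement under adjudication (D-0012/D-0089); not asserted. -/
def C60L65 (IsPT : V → V' → Prop) (D' : GammaTransformChart V' A') (D : GammaTransformChart V A) : Prop :=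
  (∀ y, y ∈ D.gamma0 ↔ ∃ y' ∈ D'.gamma0, IsPT y y') ∧ (∀ y, y ∈ D.gamma1 ↔ ∃ y' ∈ D'.gamma1, IsPT y y')

/-- **The in-proof INFERENCE of Lemma 7.4 (1) = JOINT J3 / G-H2 (C60L71–L79; p.135; anchor name by chunk + line of
«We then take the proper transforms of these equations …», C60L75).** «We can apply Lemma 7.4 (1) in the case of
ℛ̃_{ϑ[k−1]} to Z̃_{ϑ[k−1],Γ} to obtain the defining equations of Z̃_{ϑ[k−1],Γ} ∩ 𝔙' as stated in the lemma; we note here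
that these equations include ℬ^ngv_{𝔙',≥k}. We then take the proper transforms of these equations in 𝔙' to obtain the
corresponding equations in 𝔙, and then apply (the proof of) Proposition 5.16 [eq-for-sV-vtk] to reduce ℬ^ngv_{𝔙,≥k} to
ℬ^ngv_{𝔙,>k}. Because Z̃_{ϑ[k],Γ} is the proper transform of Z̃_{ϑ[k−1],Γ}, this implies Lemma 7.4 (1) in the case of
ℛ̃_{ϑ[k]}.» Typed as the inference itself, over explicit data: the parent's equations `rels' : ι → A'` with
`D'.zIdeal = span (range rels')` (+ the Γ̃-part folded into `rels'`), the element-wise «proper transform of an equation»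
`pt : A' → A` (row 106 `Def5_4`/`Def5_4_poly`, AS PRINTED), and `Z̃ ∩ 𝔙` = the strict transform of `Z̃' ∩ 𝔙'` (π, ζ):
CONCLUSION `D.zIdeal = span (range (pt ∘ rels'))`. (The reduction «≥ k to > k» by Prop. 5.16 is a re-indexing of the
same span and is left inside `rels`.) This is the sentence the J3 packet adjudicates; nothing here asserts it.
[claim: Hu2025, status: under-review]
STATUS: candidate statement under adjudication (D-0012/D-0089); not asserted. -/
def C60L75 {ι : Type*} (π : A' →+* A) (ζ : A) (pt : A' → A) (rels' : ι → A') (D' : GammaTransformChart V' A')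
    (D : GammaTransformChart V A) : Prop :=
  D'.zIdeal = Ideal.span (Set.range rels') →
    D.zIdeal = (⨆ n : ℕ, (D'.zIdeal.map π).colon ({ζ ^ n} : Set A)) →
      D.zIdeal = Ideal.span (Set.range (pt ∘ rels'))

-- sic (C61L14): the printed «because Z̃_{ϑ[k],Γ} is contained in …» can only mean Z̃_{ϑ[k−1],Γ} (the case
-- hypothesis C60L107–L111; Z̃_{ϑ[k],Γ} is not yet constructed at that point) — the decl below uses the stage-(k−1) data.
/-- **In-proof inference C61L10–L15 (p.136)** «In addition, we observe that ϑ'_{[k]} = {y'_0, y'_1} ⊂ Γ̃⁰_{𝔙'} because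
Z̃_{ϑ[k],Γ} [sic, read Z̃_{ϑ[k−1],Γ}] is contained in the proper transform Z'_{ϑ[k]} of the ϑ-center Z_{ϑ[k]}.» Typed as
the INFERENCE: from the case hypothesis «Z̃_{ϑ[k−1],Γ} ∩ 𝔙' ⊂ Z'_{ϑ[k]} ∩ 𝔙'» (SET-theoretic, C60L107–L111; the chart
ideal of `Z'_{ϑ[k]} ∩ 𝔙'` is `(y'_0, y'_1)`, C60L117–L121 «ϑ'_{[k]} = {y'_0, y'_1} ⊂ Var_{𝔙'}») to
`y'_0, y'_1 ∈ Γ̃⁰_{𝔙'}`. Its printed justification rests on the maximality clause of Lem. 7.4 (1) at stage `k − 1`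
(`Lem7_4_1max`; readings `GammaTransformChart.Gamma0Maximal` / `.gamma0Sat`); the first conjunct of `C61L20` records
the conclusion as data. [claim: Hu2025, status: under-review]
STATUS: candidate statement under adjudication (D-0012/D-0089); not asserted. -/
def C61L12 (var' : V' → A') (y0' y1' : V') (D' : GammaTransformChart V' A') : Prop :=
  Ideal.span {var' y0', var' y1'} ≤ D'.zIdeal.radical → y0' ∈ D'.gamma0 ∧ y1' ∈ D'.gamma0

/-- **Γ̄⁰ ∋ ζ in the CONTAINED case (C60L107–C61L27; p.135–136).** «We now suppose that Z̃_{ϑ[k−1],Γ} … is contained in the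
proper transform Z'_{ϑ[k]} of the ϑ-center … ϑ'_{[k]} = {y'_0, y'_1} ⊂ Var_{𝔙'} … the open chart 𝔙 is given by
(𝔙' × (ξ_0 ≡ 1)) ∩ ℛ̃_{ϑ[k]} … ζ_𝔙 … E_{ϑ[k]} ∩ 𝔙 = (ζ_𝔙 = 0) … y'_0 corresponds to (or turns into) the exceptional ζ_𝔙 …
y_1 (= ξ_1) ∈ Var_𝔙 the proper transform of y'_1 … ϑ'_{[k]} = {y'_0, y'_1} ⊂ Γ̃⁰_{𝔙'} … We set
Γ̄⁰_𝔙 = {ζ_𝔙, y_𝔙 ∣ y_𝔙 is the proper transform of some y_{𝔙'} ∈ Γ̃⁰_{𝔙'} ∖ ϑ'_{[k]}},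
Γ̄¹_𝔙 = {y_𝔙 ∣ y_𝔙 is the proper transform of some y_{𝔙'} ∈ Γ̃¹_{𝔙'}}» (displays C61L19–L27 = PDF eqs. (7.13)/(7.14) p.136; C61L53 «Observe here that
ζ_𝔙 ∈ Γ̄⁰_𝔙», after eq. (7.15) p.137). Typed on indices with `IsPT`, the centre pair `y0' y1' : V'` and the exceptional index `ζ : V`.
[claim: Hu2025, status: under-review]
STATUS: candidate statement under adjudication (D-0012/D-0089); not asserted. -/
def C61L20 [DecidableEq V'] (IsPT : V → V' → Prop) (y0' y1' : V') (ζ : V) (gamma0' gamma1' : Finset V')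
    (gammaBar0 gammaBar1 : Finset V) : Prop :=
  (y0' ∈ gamma0' ∧ y1' ∈ gamma0') ∧
  (∀ y, y ∈ gammaBar0 ↔ y = ζ ∨ ∃ y' ∈ gamma0' \ {y0', y1'}, IsPT y y') ∧
  (∀ y, y ∈ gammaBar1 ↔ ∃ y' ∈ gamma1', IsPT y y')

/-- **Definition of Z̃_{ϑ[k],Γ} under (⋆a), first sub-case (C61L109–L125; PDF eqs. (7.18)/(7.19) p.138).** «First, we suppose y_1 is identically
zero along ρ^{-1}(Z̃†°_{ϑ[k−1],Γ}). We then set Γ̃⁰_𝔙 = {y_1} ∪ Γ̄⁰_𝔙 … In this case, we let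
Z̃_{ϑ[k],Γ} = ρ_{ϑ[k]}^{-1}(Z̃_{ϑ[k−1],Γ}) ∩ D_{y_1} scheme-theoretically, where D_{y_1} is the closure of (y_1 = 0) in ℛ̃_{ϑ[k]}.»
On the chart (C61L36–L37 «ρ^{-1}(Z̃') ∩ 𝔙 = π^{-1}(Z̃') ∩ 𝒱̃_{ϑ[k]} ∩ 𝔙»): `zIdeal = zIdeal'.map π ⊔ vIdeal ⊔ (y_1)` and
`Γ̃⁰_𝔙 = {y_1} ∪ Γ̄⁰_𝔙`, `Γ̃¹_𝔙 = Γ̄¹_𝔙` (C61L153–L156), under the case hypotheses `starA`, `y1Vanishes` (Prop parameters).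
[claim: Hu2025, status: under-review]
STATUS: candidate statement under adjudication (D-0012/D-0089); not asserted. -/
def C61L122 [DecidableEq V] (starA y1Vanishes : Prop) (π : A' →+* A) (vIdeal : Ideal A) (var : V → A) (y₁ : V)
    (gammaBar0 gammaBar1 : Finset V) (D' : GammaTransformChart V' A') (D : GammaTransformChart V A) : Prop :=
  starA → y1Vanishes →
    D.zIdeal = D'.zIdeal.map π ⊔ vIdeal ⊔ Ideal.span {var y₁} ∧ D.gamma0 = insert y₁ gammaBar0 ∧ D.gamma1 = gammaBar1

/-- **Definition of Z̃_{ϑ[k],Γ} under (⋆a), second sub-case (C61L138–L156; PDF eqs. (7.20)/(7.21)/(7.22) p.138).** «Next, suppose y_1 is not identically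
zero along ρ^{-1}(Z̃†°_{ϑ[k−1],Γ}). We then set Γ̃⁰_𝔙 = Γ̄⁰_𝔙 … In this case, we let Z̃_{ϑ[k],Γ} = ρ_{ϑ[k]}^{-1}(Z̃_{ϑ[k−1],Γ}).
We always set (under the condition (⋆a)) Γ̃¹_𝔙 = Γ̄¹_𝔙.»
[claim: Hu2025, status: under-review]
STATUS: candidate statement under adjudication (D-0012/D-0089); not asserted. -/
def C61L150 (starA y1NotVanishes : Prop) (π : A' →+* A) (vIdeal : Ideal A) (gammaBar0 gammaBar1 : Finset V)
    (D' : GammaTransformChart V' A') (D : GammaTransformChart V A) : Prop :=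
  starA → y1NotVanishes →
    D.zIdeal = D'.zIdeal.map π ⊔ vIdeal ∧ D.gamma0 = gammaBar0 ∧ D.gamma1 = gammaBar1

/-- **Definition of Z̃_{ϑ[k],Γ} and Z̃† under (⋆b) (C62L50–L71 the definitions, C62L84–L88 the Γ̃-sets; p.138–139).** «In this case, we define
Z̃_{ϑ[k],Γ} = ρ^{-1}(Z̃_{ϑ[k−1],Γ}) ∩ ((ξ_0,ξ_1) = (1,1)), Z̃†_{ϑ[k],Γ} = ρ^{-1}(Z̃†_{ϑ[k−1],Γ}) ∩ ((ξ_0,ξ_1) = (1,1)), both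
scheme-theoretically … we set Γ̃⁰_𝔙 = Γ̄⁰_𝔙, Γ̃¹_𝔙 = {y_1} ∪ Γ̄¹_𝔙.» On the chart (ξ_0 ≡ 1) the condition
(ξ_0,ξ_1) = (1,1) is `y_1 = 1`.
[claim: Hu2025, status: under-review]
STATUS: candidate statement under adjudication (D-0012/D-0089); not asserted. -/
def C62L62 [DecidableEq V] (starB : Prop) (π : A' →+* A) (vIdeal : Ideal A) (var : V → A) (y₁ : V)
    (gammaBar0 gammaBar1 : Finset V) (D' : GammaTransformChart V' A') (D : GammaTransformChart V A) : Prop :=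
  starB →
    D.zIdeal = D'.zIdeal.map π ⊔ vIdeal ⊔ Ideal.span {var y₁ - 1} ∧
    D.zDagger = D'.zDagger.map π ⊔ vIdeal ⊔ Ideal.span {var y₁ - 1} ∧
    D.gamma0 = gammaBar0 ∧ D.gamma1 = insert y₁ gammaBar1

end Lem74

/-! ## Lem. 7.5 — ℘/ℓ-transforms on admissible charts (row 108 `WpEllChart`: `var`, `varVee`) and Cor. 7.6 -/

section Lem75

variable {V : Type*} {A A' : Type*} [CommRing A] [CommRing A']

/-- **Lemma 7.5, the three bullets (C62L131–C63L2; p.140).** «Fix any subset Γ of 𝐔 [sic: of Var_𝐔, cf. Def. 7.1 C57L10]. Assume that Z_Γ is integral.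
Consider (kτ)μh ∈ Index_{Φ_k} ⊔ {ℓ_k}. Then, we have the following: • there exists a closed subscheme
Z̃_{(℘_(kτ)𝔯_μ𝔰_h),Γ} of 𝒱̃_{(℘_(kτ)𝔯_μ𝔰_h)} with an induced morphism Z̃_{(℘_(kτ)𝔯_μ𝔰_h),Γ} → Z_Γ; • Z̃_{(℘_(kτ)𝔯_μ𝔰_h),Γ} comes
equipped with an irreducible component Z̃†_{(℘_(kτ)𝔯_μ𝔰_h),Γ} with the induced morphism … → Z_Γ; • for any admissible
affine chart 𝔙 of ℛ̃_{(℘_(kτ)𝔯_μ𝔰_h)} such that Z̃_{(℘_(kτ)𝔯_μ𝔰_h),Γ} ∩ 𝔙 ≠ ∅, there come equipped with Γ̃⁰_𝔙 ⊂ Var^∨_𝔙,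
Γ̃¹_𝔙 ⊂ Var_𝔙.» (Standing frame C62L124–C62L129: «as in Proposition 6.11, we assume that the last of ℛ̃_{(℘_(kτ)𝔯_μ𝔰_h)}
within the block (𝔊_k) is ℛ̃_{ℓ_k}».) On a row-108 chart: `Var_𝔙` and `Var^∨_𝔙` share the index type `V = 𝕀⋆ ⊔ Λ⋆`, so
«Γ̃⁰ ⊂ Var^∨» is carried by READING `gamma0` through `varVee` in (1) (`Lem7_5_1`).
[claim: Hu2025, status: under-review]
STATUS: candidate statement under adjudication (D-0012/D-0089); not asserted. -/
def Lem7_5_bullets {R₀ : Type*} [CommRing R₀] (hInt : Prop) (base : R₀ →+* A) (gammaWp : Ideal R₀)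
    (vIdeal : Ideal A) (D : GammaTransformChart V A) : Prop :=
  hInt → D.zIdeal ≠ ⊤ → D.LiesOverGamma base gammaWp vIdeal ∧ D.IsComponent

/-- **Lemma 7.5 (1) (C63L8–L17; p.140).** «the scheme Z̃_{(℘_(kτ)𝔯_μ𝔰_h),Γ} ∩ 𝔙, as a closed subscheme of the chart 𝔙, is
defined by the following relations y, y ∈ Γ̃⁰_𝔙, y − 1, y ∈ Γ̃¹_𝔙, ℬ^gov_𝔙, ℬ^frb_𝔙, L_{𝔉,𝔙}». `Γ̃⁰` is read through
`varVee` (third bullet «Γ̃⁰_𝔙 ⊂ Var^∨_𝔙»; C66L88–L90 «ζ_𝔙 = δ_{𝔙,(m,u_{F_k})} is not a variable in Var_𝔙, but a free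
variable in Var^∨_𝔙»), `Γ̃¹` through `var`; families as DATA `rels`.
[claim: Hu2025, status: under-review]
STATUS: candidate statement under adjudication (D-0012/D-0089); not asserted. -/
def Lem7_5_1 {ι : Type*} (hInt : Prop) (var varVee : V → A) (rels : ι → A) (D : GammaTransformChart V A) : Prop :=
  hInt → D.zIdeal ≠ ⊤ → D.DefinedBy varVee var rels

/-- **Lemma 7.5 (1), maximality clause (C63L19–L21; p.140)** — «further, we take Γ̃⁰_𝔙 ⊂ Var_𝔙 [sic: the third bullet
and Cor. 7.6 have Γ̃⁰_𝔙 ⊂ Var^∨_𝔙] to be the maximal subset (under inclusion) among all those subsets that satisfy the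
above». Typed with `Γ̃⁰` read through `varVee` (the evident reading); the literal «⊂ Var_𝔙» reading is the sibling
`Lem7_5_1max_sicVar`.
[claim: Hu2025, status: under-review]
STATUS: candidate statement under adjudication (D-0012/D-0089); not asserted. -/
def Lem7_5_1max {ι : Type*} (hInt : Prop) (var varVee : V → A) (rels : ι → A) (D : GammaTransformChart V A) :
    Prop :=
  hInt → D.zIdeal ≠ ⊤ → D.Gamma0Maximal varVee var rels

/-- **Lemma 7.5 (1), maximality clause read LITERALLY «Γ̃⁰_𝔙 ⊂ Var_𝔙»** (C63L19; sic sibling of `Lem7_5_1max`): `Γ̃⁰`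
read through `var`.
[claim: Hu2025, status: under-review]
STATUS: candidate statement under adjudication (D-0012/D-0089); not asserted. -/
def Lem7_5_1max_sicVar {ι : Type*} (hInt : Prop) (var : V → A) (rels : ι → A) (D : GammaTransformChart V A) :
    Prop :=
  hInt → D.zIdeal ≠ ⊤ → D.Gamma0Maximal var var rels

/-- **Lemma 7.5 (2) (C63L23; p.140).** «the induced morphism Z̃†_{(℘_(kτ)𝔯_μ𝔰_h),Γ} → Z_Γ is birational».
[claim: Hu2025, status: under-review]
STATUS: candidate statement under adjudication (D-0012/D-0089); not asserted. -/
def Lem7_5_2 {RΓ : Type*} [CommRing RΓ] (hInt : Prop) (D : GammaTransformChart V A)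
    (φ : RΓ →+* A ⧸ D.zDagger) : Prop :=
  hInt → D.Birational φ

/-- **Lemma 7.5 (3) (C63L25–L31; p.140).** «for any variable y ∈ Var_𝔙, Z̃† ∩ 𝔙 ⊂ (y = 0) if and only if Z̃ ∩ 𝔙 ⊂ (y = 0).
Consequently, Z̃† ∩ 𝔙 ⊂ Z̃_{φ_(kτ)μ(h+1)} ∩ 𝔙 if and only if Z̃ ∩ 𝔙 ⊂ Z̃_{φ_(kτ)μ(h+1)} ∩ 𝔙 where Z̃_{φ_(kτ)μ(h+1)} is the
proper transform of the ℘-center Z_{φ_(kτ)μ(h+1)} in ℛ̃_{(℘_(kτ)𝔯_μ𝔰_h)}.» SET-theoretic reading; `nextCentre` = chart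
ideal of that proper transform.
[claim: Hu2025, status: under-review]
STATUS: candidate statement under adjudication (D-0012/D-0089); not asserted. -/
def Lem7_5_3 (hInt : Prop) (var : V → A) (nextCentre : Ideal A) (D : GammaTransformChart V A) : Prop :=
  hInt → D.ContainedInIff var ∧
    (D.zDagger ≠ ⊤ → (nextCentre ≤ D.zDagger.radical ↔ nextCentre ≤ D.zIdeal.radical))

/-- **Lemma 7.5 (C62L131–C63L31; p.140)** = bullets ∧ (1) with maximality ∧ (2) ∧ (3).
[claim: Hu2025, status: under-review]
STATUS: candidate statement under adjudication (D-0012/D-0089); not asserted. -/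
def Lem7_5 {ι : Type*} {R₀ RΓ : Type*} [CommRing R₀] [CommRing RΓ] (hInt : Prop) (base : R₀ →+* A)
    (gammaWp : Ideal R₀) (vIdeal : Ideal A) (var varVee : V → A) (rels : ι → A) (nextCentre : Ideal A)
    (D : GammaTransformChart V A) (φ : RΓ →+* A ⧸ D.zDagger) : Prop :=
  Lem7_5_bullets hInt base gammaWp vIdeal D ∧ Lem7_5_1 hInt var varVee rels D ∧ Lem7_5_1max hInt var varVee rels D ∧
    Lem7_5_2 hInt D φ ∧ Lem7_5_3 hInt var nextCentre D

/-- **ℓ_k case of the construction: Γ̃⁰ acquires ζ_𝔙 = δ_{𝔙,(m,u_{F_k})} (C66L60–L90; displays C66L74–L82 = PDF eqs.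
(7.35)/(7.36) p.147).** «We now suppose that
Z̃_{℘_k,Γ} ∩ 𝔙' … is contained in Z_{χ_k} ∩ 𝔙' … Thus, we set Γ̃⁰_𝔙 = {ζ_𝔙, y_𝔙 ∣ y_𝔙 is the proper transform of some
y_{𝔙'} ∈ Γ̃⁰_{𝔙'} ∖ χ_k}, Γ¹_𝔙 [sic: Γ̃¹_𝔙] = {y_𝔙 ∣ y_𝔙 is the proper transform of some y_{𝔙'} ∈ Γ̃¹_{𝔙'}} … But, we need to
point out that here, ζ_𝔙 = δ_{𝔙,(m,u_{F_k})} is not a variable in Var_𝔙, but a free variable in Var^∨_𝔙.» Typed on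
indices (`V` shared by `Var`/`Var^∨`; `ζ` = the index `(m,u_{F_k})` whose `Var^∨`-reading is `δ_{𝔙,(m,u_{F_k})}`; the
ℓ-centre pair `chi' ⊂ V`).
[claim: Hu2025, status: under-review]
STATUS: candidate statement under adjudication (D-0012/D-0089); not asserted. -/
def C66L72 [DecidableEq V] (containedInChi : Prop) (IsPT : V → V → Prop) (chi' : Finset V) (ζ : V)
    (D' D : GammaTransformChart V A) : Prop :=
  containedInChi →
    (∀ y, y ∈ D.gamma0 ↔ y = ζ ∨ ∃ y' ∈ D'.gamma0 \ chi', IsPT y y') ∧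
    (∀ y, y ∈ D.gamma1 ↔ ∃ y' ∈ D'.gamma1, IsPT y y')

/-- **Corollary 7.6 (C66L106–L120; display = PDF eq. (7.37) p.147).** (C66L101–L104: «We set Z̃_{ℓ,Γ} := Z̃_{ℓ_Υ,Γ}, Z̃†_{ℓ,Γ} := Z̃†_{ℓ_Υ,Γ}».)
«Fix any admissible smooth affine chart 𝔙 of ℛ̃_ℓ as described in Lemma 7.5 such that Z̃_{ℓ,Γ} ∩ 𝔙 ≠ ∅. Then, Z̃_{ℓ,Γ} ∩ 𝔙,
as a closed subscheme of 𝔙, is defined by the following relations y, ∀ y ∈ Γ̃⁰_𝔙 ⊂ Var^∨_𝔙; y − 1, ∀ y ∈ Γ̃¹_𝔙; ℬ^gov_𝔙,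
ℬ^frb_𝔙, L_{𝔉,𝔙}.» JOINT J4 consumer (Γ̃⁰ ⊂ Var^∨) and J3 (families AS PRINTED = proper transforms, DATA `rels`).
[claim: Hu2025, status: under-review]
STATUS: candidate statement under adjudication (D-0012/D-0089); not asserted. -/
def Cor7_6 {ι : Type*} (hInt isEllStage : Prop) (var varVee : V → A) (rels : ι → A)
    (D : GammaTransformChart V A) : Prop :=
  hInt → isEllStage → D.zIdeal ≠ ⊤ → D.DefinedBy varVee var rels

/-- **Corollary 7.6, last sentence (C66L121 = the chunk's final line; PDF p.147 l.44–45, after eq. (7.37)).**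
«Furthermore, the induced morphism Z̃†_{ℓ,Γ} → Z_Γ is birational.» Ring-level on a chart meeting `Z̃†_{ℓ,Γ}`
(`GammaTransformChart.Birational`, target = I-GA's Γ-scheme ring).
[claim: Hu2025, status: under-review]
STATUS: candidate statement under adjudication (D-0012/D-0089); not asserted. -/
def Cor7_6_birational {RΓ : Type*} [CommRing RΓ] (hInt isEllStage : Prop) (D : GammaTransformChart V A)
    (φ : RΓ →+* A ⧸ D.zDagger) : Prop :=
  hInt → isEllStage → D.Birational φ

end Lem75

end Literature.AlgebraicGeometry.Hu2025.Statements.S07GammaSchemes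

end
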